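import Literature.Computability.AlgebraicComplexity.PartialMatMulAllFields
import Mathlib.Analysis.Complex.Polynomial.Basic
import HarnessLib

/-!
# ω-census tool law: the border rank over an ALGEBRAICALLY CLOSED field is invariant under scalar extension

Cell `pub-omega` (unit `pub-omega-laser-g16`), topic `Summits/MatrixMultiplication/OmegaCensus`.
Framing (verbatim): lottery ticket; floor = certified bounds/negative ranges. HONEST FRAMING: a TOOL LAW about
the tree's algebraic border rank `algBorderRank` / order-`h` approximate rank `approxRank` (Bläser 2013,
Def. 6.1, over `K[ε]`; `Literature/…/SchoenhageTau.lean`); nothing on `ω`, no census value.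

BCS 1997, Prop. (15.17)(2) says that over an algebraically closed field `k` the RESTRICTION order and the
RANK do not change under scalar extension; the tree has both (`TensorRestrictsTo.of_map_of_isAlgClosed`,
`tensorRank_map_of_isAlgClosed`, file `Literature/…/OmegaScalarExtensionInvariance.lean`) and the easy
half for border rank over any field (`approxRank_map_le`, `algBorderRank_map_le`: `R̲_L(f ∘ t) ≤ R̲_K(t)`,
file `Literature/…/PartialMatMulAllFields.lean`). This file proves the border-rank ANALOGUE of
Prop. (15.17)(2), which we did not locate in print (BCS §15.4 routes the algebraically closed case of the
degeneration order through the topological characterisation, Thm. (20.24)):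

* `exists_isApproxDecomposition_of_map_of_isAlgClosed` — an order-`h` approximate decomposition of
  `f ∘ t` with `r` triads over `L[ε]` yields one of `t` with `r` triads over `K[ε]` when `K` is
  algebraically closed (`f : K →+* L` any homomorphism of fields). Proof: the finitely many coefficients
  of the `3r` polynomial vectors satisfy polynomial equations over `K` (the coefficient conditions of
  Def. 6.1, written with GENERIC polynomials over `MvPolynomial Var K`); by the Nullstellensatz
  specialisation `exists_finiteDimensional_specialization` they can be chosen in a finite extension
  `E/K`, and `E = K`.
* `approxRank_map_of_isAlgClosed : R_h(f ∘ t) = R_h(t)` and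
  `algBorderRank_map_of_isAlgClosed : R̲_L(f ∘ t) = R̲_K(t)` (`K` algebraically closed).
* Consequences for tensors with integer entries `z` (in particular `⟨k,m,n⟩`):
  `algBorderRank_intCast_eq_of_isAlgClosed_of_charP` / `algBorderRank_matMulTensor_eq_of_isAlgClosed_of_charP`
  — over algebraically closed fields the border rank depends only on the characteristic (e.g. `ℂ` and
  `ℚ̄` alike); `algBorderRank_intCast_le_of_charZero` / `algBorderRank_matMulTensor_le_of_charZero` — a
  border-rank LOWER bound over one algebraically closed field of characteristic `0` (e.g. `ℂ`) holds over
  EVERY field of characteristic `0`, and dually an approximate decomposition over any field of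
  characteristic `0` bounds the border rank over `ℂ`.

Everything is proved; no definitions, no named facts.
-/

noncomputable section

open scoped BigOperators Polynomial

namespace Summit.MatrixMultiplication.OmegaCensus

open Literature.Computability.AlgebraicComplexity

universe u v

/-! ## Two bookkeeping lemmas on "generic" polynomials `∑_{n<N} c_n T^n` -/

section Generic

/-- Mapping the polynomial `∑_{n<N} c_n T^n` along a ring homomorphism maps its coefficients. -/
theorem map_sum_fin_monomial {R S : Type*} [CommSemiring R] [CommSemiring S] (g : R →+* S) {N : ℕ}
    (c : Fin N → R) :
    (∑ n : Fin N, Polynomial.monomial (n : ℕ) (c n)).map g =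
      ∑ n : Fin N, Polynomial.monomial (n : ℕ) (g (c n)) := by
  rw [Polynomial.map_sum]
  simp only [Polynomial.map_monomial]

/-- A polynomial of degree `< N` is the `Fin N`-indexed sum of its monomials. -/
theorem eq_sum_fin_monomial {R : Type*} [Semiring R] (p : R[X]) {N : ℕ} (hp : p.natDegree < N) :
    p = ∑ n : Fin N, Polynomial.monomial (n : ℕ) (p.coeff n) := by
  rw [← Finset.sum_range (fun n => Polynomial.monomial n (p.coeff n))]
  exact p.as_sum_range' N hp

end Generic

/-! ## Specialising an approximate decomposition to the algebraically closed ground field -/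

section Retraction

/-- Over an algebraically closed field `K`, a finite extension `E/K` is `K` itself: the inverse of the
ring isomorphism `algebraMap K E` is a retraction. -/
theorem ofBijective_algebraMap_symm_apply {K : Type u} [Field K] [IsAlgClosed K] (E : Type*) [Field E]
    [Algebra K E] [FiniteDimensional K E] (x : K) :
    (RingEquiv.ofBijective (algebraMap K E) IsAlgClosed.algebraMap_bijective_of_isIntegral).symm
      (algebraMap K E x) = x :=
  (RingEquiv.ofBijective (algebraMap K E)
    IsAlgClosed.algebraMap_bijective_of_isIntegral).symm_apply_apply x

end Retraction

section Specialise

variable {K : Type u} {L : Type v} [Field K] [Field L] [IsAlgClosed K]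
variable {ι κ μ : Type} [Fintype ι] [Fintype κ] [Fintype μ]

/-- **An approximate decomposition descends to an algebraically closed ground field.** If `f ∘ t` has an
order-`h` approximate decomposition with `r` triads over `L[ε]` (`f : K →+* L`, `K` algebraically
closed), then `t` has one with `r` triads over `K[ε]`: the coefficients of the `3r` polynomial vectors
satisfy the polynomial equations over `K` expressing Def. 6.1, hence (Nullstellensatz,
`exists_finiteDimensional_specialization`) can be taken in a finite extension of `K`, i.e. in `K`.
(Border-rank analogue of BCS 1997, Prop. (15.17)(2).) -/
theorem exists_isApproxDecomposition_of_map_of_isAlgClosed (f : K →+* L) {h : ℕ}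
    {t : ι → κ → μ → K} {r : ℕ} {u : Fin r → ι → L[X]} {v : Fin r → κ → L[X]}
    {w : Fin r → μ → L[X]} (huvw : IsApproxDecomposition h (fun a b c => f (t a b c)) u v w) :
    ∃ (u' : Fin r → ι → K[X]) (v' : Fin r → κ → K[X]) (w' : Fin r → μ → K[X]),
      IsApproxDecomposition h t u' v' w' := by
  classical
  letI : Algebra K L := f.toAlgebra
  -- a common strict bound on the degrees of all the polynomials involved
  obtain ⟨N, hNu, hNv, hNw⟩ : ∃ N : ℕ, (∀ ρ a, (u ρ a).natDegree < N) ∧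
      (∀ ρ b, (v ρ b).natDegree < N) ∧ (∀ ρ c, (w ρ c).natDegree < N) := by
    refine ⟨(Finset.univ.sup fun p : Fin r × ι => (u p.1 p.2).natDegree) +
      (Finset.univ.sup fun p : Fin r × κ => (v p.1 p.2).natDegree) +
      (Finset.univ.sup fun p : Fin r × μ => (w p.1 p.2).natDegree) + 1,
      fun ρ a => ?_, fun ρ b => ?_, fun ρ c => ?_⟩
    · have hle : (u ρ a).natDegree ≤ Finset.univ.sup fun p : Fin r × ι => (u p.1 p.2).natDegree :=
        Finset.le_sup (f := fun p : Fin r × ι => (u p.1 p.2).natDegree) (Finset.mem_univ (ρ, a))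
      omega
    · have hle : (v ρ b).natDegree ≤ Finset.univ.sup fun p : Fin r × κ => (v p.1 p.2).natDegree :=
        Finset.le_sup (f := fun p : Fin r × κ => (v p.1 p.2).natDegree) (Finset.mem_univ (ρ, b))
      omega
    · have hle : (w ρ c).natDegree ≤ Finset.univ.sup fun p : Fin r × μ => (w p.1 p.2).natDegree :=
        Finset.le_sup (f := fun p : Fin r × μ => (w p.1 p.2).natDegree) (Finset.mem_univ (ρ, c))
      omega
  -- one variable per coefficient slot
  let Var : Type := (Fin r × ι × Fin N) ⊕ (Fin r × κ × Fin N) ⊕ (Fin r × μ × Fin N)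
  let val : Var → L := Sum.elim (fun p => (u p.1 p.2.1).coeff p.2.2)
    (Sum.elim (fun p => (v p.1 p.2.1).coeff p.2.2) (fun p => (w p.1 p.2.1).coeff p.2.2))
  -- the generic polynomial vectors over `MvPolynomial Var K`
  let U : Fin r → ι → (MvPolynomial Var K)[X] := fun ρ a =>
    ∑ n : Fin N, Polynomial.monomial (n : ℕ) (MvPolynomial.X (Sum.inl (ρ, a, n)))
  let V : Fin r → κ → (MvPolynomial Var K)[X] := fun ρ b =>
    ∑ n : Fin N, Polynomial.monomial (n : ℕ) (MvPolynomial.X (Sum.inr (Sum.inl (ρ, b, n))))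
  let W : Fin r → μ → (MvPolynomial Var K)[X] := fun ρ c =>
    ∑ n : Fin N, Polynomial.monomial (n : ℕ) (MvPolynomial.X (Sum.inr (Sum.inr (ρ, c, n))))
  -- pushing a ring homomorphism through the coefficient of the triple-product sum
  have hcoeff : ∀ {S : Type v} [CommSemiring S] (g : MvPolynomial Var K →+* S) (a : ι) (b : κ) (c : μ)
      (j : ℕ), g ((∑ ρ, U ρ a * V ρ b * W ρ c).coeff j) =
        (∑ ρ, (U ρ a).map g * (V ρ b).map g * (W ρ c).map g).coeff j := by
    intro S _ g a b c j
    rw [← Polynomial.coeff_map, Polynomial.map_sum]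
    simp only [Polynomial.map_mul]
  have hcoeffK : ∀ (g : MvPolynomial Var K →+* K) (a : ι) (b : κ) (c : μ) (j : ℕ),
      g ((∑ ρ, U ρ a * V ρ b * W ρ c).coeff j) =
        (∑ ρ, (U ρ a).map g * (V ρ b).map g * (W ρ c).map g).coeff j := by
    intro g a b c j
    rw [← Polynomial.coeff_map, Polynomial.map_sum]
    simp only [Polynomial.map_mul]
  -- evaluating the generic vectors at `val` gives back `u, v, w`
  let φ : MvPolynomial Var K →+* L := (MvPolynomial.aeval val).toRingHom
  have hφ : ∀ P, φ P = MvPolynomial.aeval val P := fun _ => rfl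
  have hφC : ∀ x : K, φ (MvPolynomial.C x) = f x := by
    intro x
    rw [hφ, MvPolynomial.aeval_C, RingHom.algebraMap_toAlgebra]
  have hU : ∀ ρ a, (U ρ a).map φ = u ρ a := by
    intro ρ a
    show (∑ n : Fin N, Polynomial.monomial (n : ℕ) (MvPolynomial.X (Sum.inl (ρ, a, n)) : MvPolynomial Var K)).map φ
      = u ρ a
    rw [map_sum_fin_monomial]
    conv_rhs => rw [eq_sum_fin_monomial (u ρ a) (hNu ρ a)]
    refine Finset.sum_congr rfl fun n _ => ?_
    rw [hφ, MvPolynomial.aeval_X]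
    rfl
  have hV : ∀ ρ b, (V ρ b).map φ = v ρ b := by
    intro ρ b
    show (∑ n : Fin N, Polynomial.monomial (n : ℕ) (MvPolynomial.X (Sum.inr (Sum.inl (ρ, b, n))) : MvPolynomial Var K)).map φ
      = v ρ b
    rw [map_sum_fin_monomial]
    conv_rhs => rw [eq_sum_fin_monomial (v ρ b) (hNv ρ b)]
    refine Finset.sum_congr rfl fun n _ => ?_
    rw [hφ, MvPolynomial.aeval_X]
    rfl
  have hW : ∀ ρ c, (W ρ c).map φ = w ρ c := by
    intro ρ c
    show (∑ n : Fin N, Polynomial.monomial (n : ℕ) (MvPolynomial.X (Sum.inr (Sum.inr (ρ, c, n))) : MvPolynomial Var K)).map φ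
      = w ρ c
    rw [map_sum_fin_monomial]
    conv_rhs => rw [eq_sum_fin_monomial (w ρ c) (hNw ρ c)]
    refine Finset.sum_congr rfl fun n _ => ?_
    rw [hφ, MvPolynomial.aeval_X]
    rfl
  -- the relations over `K` satisfied by the coefficients: Def. 6.1 for `f ∘ t`
  let P : ι → κ → μ → ℕ → MvPolynomial Var K := fun a b c j =>
    (∑ ρ, U ρ a * V ρ b * W ρ c).coeff j - MvPolynomial.C (if j = h then t a b c else 0)
  have hP : ∀ a b c, ∀ j ≤ h, MvPolynomial.aeval val (P a b c j) = 0 := by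
    intro a b c j hj
    show φ ((∑ ρ, U ρ a * V ρ b * W ρ c).coeff j - MvPolynomial.C (if j = h then t a b c else 0)) = 0
    rw [map_sub, hcoeff φ a b c j, hφC, sub_eq_zero]
    simp only [hU, hV, hW]
    rw [huvw a b c j hj]
    split_ifs <;> simp
  -- specialise to a finite extension `E` of `K`, which is `K`
  obtain ⟨E, _instF, _instA, _instFD, val', hval'⟩ :=
    exists_finiteDimensional_specialization (K := K) (L := L) val
  let e : E ≃+* K :=
    (RingEquiv.ofBijective (algebraMap K E) IsAlgClosed.algebraMap_bijective_of_isIntegral).symm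
  let g : MvPolynomial Var K →+* K := e.toRingHom.comp (MvPolynomial.aeval val').toRingHom
  have hg : ∀ Q, g Q = e (MvPolynomial.aeval val' Q) := fun _ => rfl
  have hgC : ∀ x : K, g (MvPolynomial.C x) = x := by
    intro x
    rw [hg, MvPolynomial.aeval_C]
    exact ofBijective_algebraMap_symm_apply (K := K) E x
  have hgP : ∀ a b c, ∀ j ≤ h, g (P a b c j) = 0 := by
    intro a b c j hj
    rw [hg, hval' (P a b c j) (hP a b c j hj), map_zero]
  refine ⟨fun ρ a => (U ρ a).map g, fun ρ b => (V ρ b).map g, fun ρ c => (W ρ c).map g, ?_⟩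
  intro a b c j hj
  show (∑ ρ, (U ρ a).map g * (V ρ b).map g * (W ρ c).map g).coeff j = if j = h then t a b c else 0
  have hsplit : (∑ ρ, U ρ a * V ρ b * W ρ c).coeff j =
      P a b c j + MvPolynomial.C (if j = h then t a b c else 0) := by
    simp only [P, sub_add_cancel]
  rw [← hcoeffK g a b c j, hsplit, map_add, hgP a b c j hj, zero_add, hgC]

/-- **`R_h(f ∘ t) = R_h(t)` over an algebraically closed field `K`**: the order-`h` approximate rank does
not change under scalar extension along any `f : K →+* L` (border-rank analogue of BCS Prop. (15.17)(2);
`≤` is `approxRank_map_le` over any field). -/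
theorem approxRank_map_of_isAlgClosed (f : K →+* L) (h : ℕ) (t : ι → κ → μ → K) :
    approxRank h (fun a b c => f (t a b c)) = approxRank h t := by
  classical
  refine le_antisymm (approxRank_map_le f h t) ?_
  have hne : {r : ℕ | ∃ (u : Fin r → ι → L[X]) (v : Fin r → κ → L[X]) (w : Fin r → μ → L[X]),
      IsApproxDecomposition h (fun a b c => f (t a b c)) u v w}.Nonempty := by
    obtain ⟨r, u, v, w, huvw⟩ := exists_isApproxDecomposition h (fun a b c => f (t a b c))
    exact ⟨r, u, v, w, huvw⟩
  obtain ⟨u, v, w, huvw⟩ := Nat.sInf_mem hne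
  obtain ⟨u', v', w', h'⟩ := exists_isApproxDecomposition_of_map_of_isAlgClosed f huvw
  exact approxRank_le_of_isApproxDecomposition h'

/-- **`R̲_L(f ∘ t) = R̲_K(t)` over an algebraically closed field `K`**: the border rank does not change
under scalar extension along any homomorphism of fields `f : K →+* L` (border-rank analogue of BCS
Prop. (15.17)(2)). -/
theorem algBorderRank_map_of_isAlgClosed (f : K →+* L) (t : ι → κ → μ → K) :
    algBorderRank (fun a b c => f (t a b c)) = algBorderRank t := by
  unfold algBorderRank
  exact congrArg iInf (funext fun h => approxRank_map_of_isAlgClosed f h t)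

end Specialise

/-! ## Consequences for tensors with integer entries, in particular `⟨k,m,n⟩` -/

section IntCast

variable {ι κ μ : Type} [Fintype ι] [Fintype κ] [Fintype μ]

/-- Along any homomorphism from an ALGEBRAICALLY CLOSED field `K₀` into a field `K`, a tensor `z` with
integer entries has the same border rank over `K` as over `K₀`. -/
theorem algBorderRank_intCast_eq_of_ringHom_of_isAlgClosed {K₀ : Type u} {K : Type v} [Field K₀]
    [Field K] [IsAlgClosed K₀] (f : K₀ →+* K) (z : ι → κ → μ → ℤ) :
    algBorderRank (fun a b c => (z a b c : K)) = algBorderRank (fun a b c => (z a b c : K₀)) := by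
  have hz : (fun a b c => f (z a b c : K₀)) = fun a b c => (z a b c : K) := by
    funext a b c
    exact map_intCast f _
  rw [← hz]
  exact algBorderRank_map_of_isAlgClosed f _

/-- **The border rank of an integer tensor over an algebraically closed field depends only on the
characteristic**: if `K` and `L` are algebraically closed fields of the same characteristic `p` then
`R̲_K(z) = R̲_L(z)` — both contain a copy of the algebraic closure of the prime field (`IsAlgClosed.lift`).
So a border-rank statement "over algebraically closed fields of characteristic `0`" is ONE statement,
for `ℂ` and `ℚ̄` alike. -/
theorem algBorderRank_intCast_eq_of_isAlgClosed_of_charP (K : Type u) (L : Type v) [Field K]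
    [Field L] [IsAlgClosed K] [IsAlgClosed L] (p : ℕ) [CharP K p] [CharP L p]
    (z : ι → κ → μ → ℤ) :
    algBorderRank (fun a b c => (z a b c : K)) = algBorderRank (fun a b c => (z a b c : L)) := by
  rcases CharP.char_is_prime_or_zero K p with hp | hp
  · haveI : Fact p.Prime := ⟨hp⟩
    letI : Algebra (ZMod p) K := ZMod.algebra _ _
    letI : Algebra (ZMod p) L := ZMod.algebra _ _
    let fK : AlgebraicClosure (ZMod p) →ₐ[ZMod p] K := IsAlgClosed.lift
    let fL : AlgebraicClosure (ZMod p) →ₐ[ZMod p] L := IsAlgClosed.lift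
    rw [algBorderRank_intCast_eq_of_ringHom_of_isAlgClosed fK.toRingHom,
      algBorderRank_intCast_eq_of_ringHom_of_isAlgClosed fL.toRingHom]
  · subst hp
    letI : CharZero K := CharP.charP_to_charZero K
    letI : CharZero L := CharP.charP_to_charZero L
    -- the two `ℚ`-algebra structures on `ℚ̄` agree, but not reducibly: transport the instance
    haveI : Algebra.IsAlgebraic ℚ (AlgebraicClosure ℚ) := by
      convert AlgebraicClosure.isAlgebraic ℚ <;> rfl
    let fK : AlgebraicClosure ℚ →ₐ[ℚ] K := IsAlgClosed.lift
    let fL : AlgebraicClosure ℚ →ₐ[ℚ] L := IsAlgClosed.lift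
    rw [algBorderRank_intCast_eq_of_ringHom_of_isAlgClosed fK.toRingHom,
      algBorderRank_intCast_eq_of_ringHom_of_isAlgClosed fL.toRingHom]

/-- **Border-rank lower bounds over `ℂ` hold over every field of characteristic `0`** (and dually, upper
bounds over any field of characteristic `0` hold over `ℂ`): for an integer tensor `z`, an algebraically
closed field `K₀` of characteristic `0` and ANY field `K` of characteristic `0`,
`R̲_{K₀}(z) ≤ R̲_K(z)` — pass to the algebraic closure `K̄` (`algBorderRank_map_le`), where the border
rank equals the one over `K₀` (`algBorderRank_intCast_eq_of_isAlgClosed_of_charP`). -/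
theorem algBorderRank_intCast_le_of_charZero (K₀ : Type u) (K : Type v) [Field K₀] [Field K]
    [IsAlgClosed K₀] [CharZero K₀] [CharZero K] (z : ι → κ → μ → ℤ) :
    algBorderRank (fun a b c => (z a b c : K₀)) ≤ algBorderRank (fun a b c => (z a b c : K)) := by
  classical
  have hz : (fun a b c => algebraMap K (AlgebraicClosure K) (z a b c : K)) =
      fun a b c => (z a b c : AlgebraicClosure K) := by
    funext a b c
    exact map_intCast _ _
  rw [← algBorderRank_intCast_eq_of_isAlgClosed_of_charP (AlgebraicClosure K) K₀ 0 z, ← hz]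
  exact algBorderRank_map_le _ _

end IntCast

section MatMul

/-- Along any homomorphism from an ALGEBRAICALLY CLOSED field `K₀` into a field `K`,
`R̲_K(⟨k,m,n⟩) = R̲_{K₀}(⟨k,m,n⟩)` (`⟨k,m,n⟩` has entries `0, 1`; `matMulTensor_map`). -/
theorem algBorderRank_matMulTensor_eq_of_ringHom_of_isAlgClosed {K₀ : Type u} {K : Type v}
    [Field K₀] [Field K] [IsAlgClosed K₀] (f : K₀ →+* K) (k m n : ℕ) :
    algBorderRank (matMulTensor K k m n) = algBorderRank (matMulTensor K₀ k m n) := by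
  rw [← matMulTensor_map f k m n]
  exact algBorderRank_map_of_isAlgClosed f _

/-- **The border rank of matrix multiplication over an algebraically closed field depends only on the
characteristic**: `R̲_K(⟨k,m,n⟩) = R̲_L(⟨k,m,n⟩)` for algebraically closed `K`, `L` of the same
characteristic `p`. -/
theorem algBorderRank_matMulTensor_eq_of_isAlgClosed_of_charP (K : Type u) (L : Type v) [Field K]
    [Field L] [IsAlgClosed K] [IsAlgClosed L] (p : ℕ) [CharP K p] [CharP L p] (k m n : ℕ) :
    algBorderRank (matMulTensor K k m n) = algBorderRank (matMulTensor L k m n) := by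
  rcases CharP.char_is_prime_or_zero K p with hp | hp
  · haveI : Fact p.Prime := ⟨hp⟩
    letI : Algebra (ZMod p) K := ZMod.algebra _ _
    letI : Algebra (ZMod p) L := ZMod.algebra _ _
    let fK : AlgebraicClosure (ZMod p) →ₐ[ZMod p] K := IsAlgClosed.lift
    let fL : AlgebraicClosure (ZMod p) →ₐ[ZMod p] L := IsAlgClosed.lift
    rw [algBorderRank_matMulTensor_eq_of_ringHom_of_isAlgClosed fK.toRingHom,
      algBorderRank_matMulTensor_eq_of_ringHom_of_isAlgClosed fL.toRingHom]
  · subst hp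
    letI : CharZero K := CharP.charP_to_charZero K
    letI : CharZero L := CharP.charP_to_charZero L
    haveI : Algebra.IsAlgebraic ℚ (AlgebraicClosure ℚ) := by
      convert AlgebraicClosure.isAlgebraic ℚ <;> rfl
    let fK : AlgebraicClosure ℚ →ₐ[ℚ] K := IsAlgClosed.lift
    let fL : AlgebraicClosure ℚ →ₐ[ℚ] L := IsAlgClosed.lift
    rw [algBorderRank_matMulTensor_eq_of_ringHom_of_isAlgClosed fK.toRingHom,
      algBorderRank_matMulTensor_eq_of_ringHom_of_isAlgClosed fL.toRingHom]

/-- **Border-rank lower bounds for `⟨k,m,n⟩` over `ℂ` hold over every field of characteristic `0`**: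
`R̲_{K₀}(⟨k,m,n⟩) ≤ R̲_K(⟨k,m,n⟩)` for `K₀` algebraically closed of characteristic `0` (e.g. `ℂ`) and
any field `K` of characteristic `0`; equivalently an approximate decomposition of `⟨k,m,n⟩` found over ANY
field of characteristic `0` bounds `R̲_ℂ(⟨k,m,n⟩)`. -/
theorem algBorderRank_matMulTensor_le_of_charZero (K₀ : Type u) (K : Type v) [Field K₀] [Field K]
    [IsAlgClosed K₀] [CharZero K₀] [CharZero K] (k m n : ℕ) :
    algBorderRank (matMulTensor K₀ k m n) ≤ algBorderRank (matMulTensor K k m n) := by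
  classical
  rw [← algBorderRank_matMulTensor_eq_of_isAlgClosed_of_charP (AlgebraicClosure K) K₀ 0 k m n,
    ← matMulTensor_map (algebraMap K (AlgebraicClosure K)) k m n]
  exact algBorderRank_map_le _ _

/-- In particular `R̲_K(⟨k,m,n⟩) = R̲_ℂ(⟨k,m,n⟩)` for every algebraically closed field `K` of
characteristic `0`. -/
theorem algBorderRank_matMulTensor_eq_complex (K : Type u) [Field K] [IsAlgClosed K] [CharZero K]
    (k m n : ℕ) : algBorderRank (matMulTensor K k m n) = algBorderRank (matMulTensor ℂ k m n) :=
  algBorderRank_matMulTensor_eq_of_isAlgClosed_of_charP K ℂ 0 k m n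

end MatMul

end Summit.MatrixMultiplication.OmegaCensus

end
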